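import Summits.CriticalPhenomena.PercolationContinuityZ3.Theorems.FK.Transplant.KNFreeTheorem6
import Literature.Probability.Percolation.KozmaNitzanTheorem6
import HarnessLib

/-!
# FK-continuity transplant, FT-07 (f): soundness of Kozma–Nitzan's FK scheme and C3b `FKLawfulOfCriterion`

Cell `fk-continuity` (bschramm), FRONTIER TRANSPLANT sub-cell, row FT-07 (`KNFreeTheorem6`); support file
(`--supports stmt-CriticalPhenomena-4575`); builds on p205010 (kernel theorem, internal audit signed; external
expert review pending). HONEST FRAMING: the transplant this file serves is CONDITIONAL on the free-boundary
penetration hypothesis FH (open at the same `p` for `q > 1`; ⇔ GRC Conj. (5.103) via K1; barrier note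
`Literature.Barriers.CriticalPhenomena.SamePFreeBoundaryCriteria`); a typed reduction, not a proof of FK continuity.
THIS file is unconditional: no named facts, no sorries, standard axioms; `FH` does not occur in it. It proves
FO-05's programme statement C3b `FKLawfulOfCriterion d q` for every `q ≥ 1` (expected provable per FO-05; the
OPEN statements of the programme are C3a / FH / TP_FK, untouched here).

## What is here

* `RunFK.exists_exit` — the certificate of (32) for the FK run (port of tree `KSch.exists_exit`): after an
  FK-valid history, on the initial event, the configuration itself has an open path inside the explored region
  from `0` to a lattice neighbour of `E_{w,v}`. The law enters once: an event of positive `fkLaw`-probability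
  meets the almost-sure set "no pair of weight `0` is open" (FT-06b `IsPinningLaw.subset/null` for `fkLaw`,
  FT-06d), so a witnessing configuration exists; the rest is the tree's path surgery.
* `RunFK.mem_percolatesVia_of_infinite` — an infinite macro-cluster forces an infinite open cluster of the
  origin in the slab (port of tree `KSch.mem_percolatesVia_of_infinite`, law-free after `exists_exit`).
* `knScheme_sound` — FO-05 `FKScheme.Sound` for `knScheme S q`.
* **`fkLawfulOfCriterion (hq : 1 ≤ q) : FKLawfulOfCriterion d q`** — C3b: a `UFSC0 d q p r ε₀` witness yields a
  sound FK history scheme robustly lawful at `(p, 4ε₀)` with `knFreshBound S` fresh edges per region.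

## References

* G. Kozma, S. Nitzan, arXiv:2401.12397 (2024), §4 pp. 25–31 ((2)–(3), (28)–(33)). [KozmaNitzan2024]
* G. Grimmett, *The Random-Cluster Model*, Springer 2006: Thm. (3.7), eq. (3.22). [Grimmett2006]
-/

noncomputable section

open MeasureTheory Finset
open scoped ENNReal Classical

namespace Summit.CriticalPhenomena.PercolationContinuityZ3.Theorems.FK

open Literature.Probability.Percolation Literature.Probability.LatticeModels SimpleGraph
open Literature.Probability.Percolation.GadgetSystem Literature.Probability.Percolation.KozmaNitzan
open ProbeHistory HSiteScheme KSch Cells Transplant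

variable {d : ℕ} {S : KSch d} {q : ℝ}

/-- A positive-probability event meets two events of null complement. [folklore] -/
theorem nonempty_inter_of_real_pos {α : Type*} [MeasurableSpace α] {μ : Measure α} [IsFiniteMeasure μ]
    {E A B : Set α} (hE : 0 < μ.real E) (hA : μ.real Aᶜ = 0) (hB : μ.real Bᶜ = 0) : (E ∩ (A ∩ B)).Nonempty := by
  by_contra h
  rw [Set.not_nonempty_iff_eq_empty] at h
  have hsub : E ⊆ Aᶜ ∪ Bᶜ := by
    intro x hx
    by_cases hxA : x ∈ A
    · by_cases hxB : x ∈ B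
      · have : x ∈ E ∩ (A ∩ B) := ⟨hx, hxA, hxB⟩
        rw [h] at this
        exact absurd this (Set.notMem_empty x)
      · exact Or.inr hxB
    · exact Or.inl hxA
  have h1 := measureReal_mono (μ := μ) hsub
  have h3 := measureReal_union_le (μ := μ) Aᶜ Bᶜ
  linarith

/-- **Almost surely under `fkLaw Λ W q` (`q ≥ 1`) no pair of weight `0` is open.** [cite: Grimmett2006, Thm. (3.7)] -/
theorem fkLaw_real_compl_setOf_weight_zero (Λ : Finset (Site d)) (W : Sym2 (Site d) → unitInterval) (hq : 1 ≤ q) :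
    (fkLaw Λ W q).real {η | ∀ x : Sym2 (Site d), W x = 0 → x ∉ η}ᶜ = 0 := by
  have hL := isPinningLaw_fkLaw Λ hq
  set D : Set (Sym2 (Site d)) := Set.range (Sym2.map (Subtype.val : ↥Λ → Site d)) with hD
  haveI := hL.prob W
  set K : Set (Sym2 (Site d)) := {x | x ∈ D ∧ W x = 0} with hK
  have hKD : K ⊆ D := fun x hx => hx.1
  have hN := hL.null W K ∅ hKD (Set.to_countable _) (fun i _ hi => absurd hi (Set.notMem_empty i))
    (fun i hi _ => hi.2)
  have hS := hL.subset W
  -- `{no weight-0 pair open} ⊇ {η ⊆ D} ∩ localCylinder K ∅`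
  have hsub : {η : Set (Sym2 (Site d)) | ∀ x, W x = 0 → x ∉ η}ᶜ ⊆ {η | η ⊆ D}ᶜ ∪ (localCylinder K (∅ : Set (Sym2 (Site d))))ᶜ := by
    intro η hη
    rw [Set.mem_compl_iff, Set.mem_setOf_eq] at hη
    push Not at hη
    obtain ⟨x, hx0, hxη⟩ := hη
    by_cases hηD : η ⊆ D
    · refine Or.inr fun hcyl => ?_
      have := (hcyl x ⟨hηD hxη, hx0⟩).1 hxη
      exact absurd this (Set.notMem_empty x)
    · exact Or.inl hηD
  refine le_antisymm ?_ measureReal_nonneg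
  calc (fkLaw Λ W q).real {η | ∀ x : Sym2 (Site d), W x = 0 → x ∉ η}ᶜ
      ≤ (fkLaw Λ W q).real ({η | η ⊆ D}ᶜ ∪ (localCylinder K (∅ : Set (Sym2 (Site d))))ᶜ) := measureReal_mono hsub
    _ ≤ (fkLaw Λ W q).real {η | η ⊆ D}ᶜ + (fkLaw Λ W q).real (localCylinder K (∅ : Set (Sym2 (Site d))))ᶜ :=
        measureReal_union_le _ _
    _ = 0 := by rw [hS, hN, add_zero]

namespace RunFK

/-- **The certificate of (32) for the FK run** (KN p. 26, (3)): after an FK-valid history the configuration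
itself has an open path inside the explored region from the origin to a lattice neighbour of `E_{w,v}` —
(32) is a positive probability under the FK law of the weighting pinned on the recorded pattern, which on the
initial event is the configuration's own. Port of tree `KSch.exists_exit`.
[cite: KozmaNitzan2024, §4 p. 26 ((3)) and p. 28 ((32))] -/
theorem exists_exit (hq : 1 ≤ q) (hδc : S.δc ≤ 1) {ω : BondConfig (Site d)} (hA : ω ∈ initEvent (schemeFK S q))
    {n : ℕ} {e : Site 2 × MDir} (hV : ValidFK S q (hst S q ω n) e) :
    ∃ a ∈ S.V (hst S q ω n), PathIn (openGraph ω) (↑(S.V (hst S q ω n)) : Set (Site d)) 0 a ∧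
      ∃ b ∈ S.C.Ewv e.1 e.2, (zdGraph d).Adj a b := by
  set W := S.W₀ (hst S q ω n) e with hW
  set P := fkLaw (S.V (hst S q ω n) ∪ S.C.Ewv e.1 e.2) W q with hP
  have hI := runInv S q ω n
  have hV' : (geomTwin S).Valid (hst S q ω n) e := geomTwin_valid_of_validFK hV
  haveI : IsProbabilityMeasure P := (isPinningLaw_fkLaw (S.V (hst S q ω n) ∪ S.C.Ewv e.1 e.2) hq).prob W
  have hpos : 0 < P.real (⋃ t ∈ S.C.M (tgt e), openConn (0 : Site d) t) :=
    lt_of_le_of_lt (by linarith) hV.reach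
  -- almost surely no pair of weight zero is open: a witnessing configuration exists
  have hne := nonempty_inter_of_real_pos hpos (fkLaw_real_compl_setOf_weight_zero _ W hq)
    (fkLaw_real_compl_setOf_weight_zero _ W hq)
  obtain ⟨η, hηA, hη0, -⟩ := hne
  simp only [Set.mem_iUnion, exists_prop] at hηA
  obtain ⟨t, ht, hreach⟩ := hηA
  have hopen : ∀ x y, (openGraph η).Adj x y → W s(x, y) ≠ 0 := fun x y hxy h0 =>
    hη0 _ h0 ((openGraph_adj _ _ _).1 hxy).1
  -- the open path from `0` to `M_v` inside `E_i ∪ E_{w,v}` and its first exit from `E_i`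
  have hηwire : ∀ x ∈ η, x ∈ wireSet (↑(S.V (hst S q ω n) ∪ S.C.Ewv e.1 e.2) : Set (Site d)) := by
    intro x hx
    by_contra hxS
    exact hη0 x (by rw [hW, KSch.W₀]; exact restrW_apply_of_not_mem _ hxS) hx
  have hpath := pathIn_of_reachable_of_forall_mem_wireSet hηwire
    (Finset.mem_coe.2 (Finset.mem_union_left _ hV.zero_mem)) hreach
  have htV : t ∉ (↑(S.V (hst S q ω n)) : Set (Site d)) := fun h =>
    (KSch.Valid.sep_Q hV').not_mem h (Finset.mem_coe.2 (S.M_subset_Q _ ht))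
  obtain ⟨a, b, ha, hb, hbU, hab, hpa⟩ := hpath.exit (R := (↑(S.V (hst S q ω n)) : Set (Site d)))
    (Finset.mem_coe.2 hV.zero_mem) htV
  have hbE : b ∈ S.C.Ewv e.1 e.2 := by
    rcases Finset.mem_union.1 (Finset.mem_coe.1 hbU) with h | h
    · exact absurd (Finset.mem_coe.2 h) hb
    · exact h
  have haU : a ∈ (↑(S.V (hst S q ω n) ∪ S.C.Ewv e.1 e.2) : Set (Site d)) :=
    Finset.mem_coe.2 (Finset.mem_union_left _ (Finset.mem_coe.1 ha))
  -- the exit edge is a lattice edge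
  have hab' : (zdGraph d).Adj a b := by
    have h1 := hopen a b hab
    rw [hW, KSch.W₀, restrW_apply_of_mem _ (mk_mem_wireSet_iff.2 ⟨haU, hbU, hab.ne⟩)] at h1
    have hF : s(a, b) ∉ (↑(S.F (hst S q ω n)) : Set (Sym2 (Site d))) := by
      intro h
      rw [Finset.mem_coe, hI.F_eq, mem_edgesIn_iff] at h
      exact hb (Finset.mem_coe.2 (h.2 b (Sym2.mem_mk_right _ _)))
    rw [pinW_apply_of_not_mem _ _ hF, lattW_mk] at h1
    by_contra hnadj
    rw [if_neg hnadj] at h1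
    exact h1 rfl
  -- the initial segment is `ω`-open
  have hpa' : PathIn (openGraph ω) (↑(S.V (hst S q ω n)) : Set (Site d)) 0 a := by
    refine (DCT16.pathIn_congrGraph (fun x y hx hy hxy => ?_) hpa).mono Set.inter_subset_left
    have hxV : x ∈ S.V (hst S q ω n) := Finset.mem_coe.1 hx.1
    have hyV : y ∈ S.V (hst S q ω n) := Finset.mem_coe.1 hy.1
    have h1 := hopen x y hxy
    have hne := hxy.ne
    rw [hW, KSch.W₀, restrW_apply_of_mem _ (mk_mem_wireSet_iff.2 ⟨hx.2, hy.2, hne⟩)] at h1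
    by_cases hF : s(x, y) ∈ (↑(S.F (hst S q ω n)) : Set (Sym2 (Site d)))
    · have hξ : s(x, y) ∈ (↑(S.ξ (hst S q ω n)) : Set (Sym2 (Site d))) := by
        by_contra hξ
        rw [pinW_apply_of_mem_of_not_mem _ hF hξ] at h1
        exact h1 rfl
      rw [openGraph_adj]
      rcases ((hI.ξ_iff _).1 (Finset.mem_coe.1 hξ)).2 with h | h
      · exact ⟨h, hne⟩
      · exact ⟨hA (Finset.mem_coe.2 h), hne⟩
    · exfalso
      rw [pinW_apply_of_not_mem _ _ hF, lattW_mk] at h1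
      by_cases hadj : (zdGraph d).Adj x y
      · apply hF
        rw [Finset.mem_coe, hI.F_eq, mem_edgesIn_iff]
        refine ⟨(SimpleGraph.mem_edgeSet _).2 hadj, fun z hz => ?_⟩
        rcases Sym2.mem_iff.1 hz with rfl | rfl
        · exact hxV
        · exact hyV
      · rw [if_neg hadj] at h1
        exact h1 rfl
  exact ⟨a, Finset.mem_coe.1 ha, hpa', b, hbE, hab'⟩

/-- The explored region of the FK run stays in the slab. [cite: KozmaNitzan2024, §4 p. 27] -/
theorem V_subset_slab (ω : BondConfig (Site d)) (n : ℕ) : (↑(S.V (hst S q ω n)) : Set (Site d)) ⊆ S.slab :=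
  (V_subset_Cover (S := S) (q := q) (ω := ω) n).trans (S.Cover_subset_slab _)

/-- **An infinite macro-cluster of the FK run forces an infinite open cluster of the origin inside the slab**
(KN pp. 26–27: "the combination of (2) and (3)"). Port of tree `KSch.mem_percolatesVia_of_infinite`.
[cite: KozmaNitzan2024, §4 pp. 26–27] -/
theorem mem_percolatesVia_of_infinite (hq : 1 ≤ q) (hδc : S.δc ≤ 1) (hQ0 : ∀ du : MDir, OriginFK S q du)
    {ω : BondConfig (Site d)} (hωE : ω ⊆ (zdGraph d).edgeSet) (hA : ω ∈ initEvent (schemeFK S q))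
    (hinf : ((schemeFK S q).occFinal ω).Infinite) :
    ω ∈ percolatesVia (withinGraph (zdGraph d) S.slab) (0 : Site d) := by
  set Cl := openClusterIn (withinGraph (zdGraph d) S.slab) ω 0 with hCl
  have hr1 : (1 : ℤ) ≤ S.C.r := by exact_mod_cast S.C.r_pos
  have hnear : ∀ b ∈ (schemeFK S q).occFinal ω, b ≠ 0 →
      ∃ a ∈ Cl, ∀ i : Fin 2, |20 * (S.C.r : ℤ) * b i - a (S.C.pax i)| ≤ 16 * S.C.r := by
    intro b hb hb0
    obtain ⟨n, hbn⟩ := Set.mem_iUnion.1 hb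
    rcases (schemeFK S q).exists_probe_of_det ω n b (Or.inl hbn) with h | ⟨m, -, e, P, hc, hte, hP, -⟩
    · exact absurd h hb0
    obtain ⟨e', hc', -, rfl⟩ := of_next_some (S := S) (q := q) hP
    have hee : e' = e := Option.some_injective _ (hc'.symm.trans hc)
    subst hee
    have hV : ValidFK S q (hst S q ω m) e' := validFK_of_choice hq hQ0 hc
    obtain ⟨a, haV, hpa, b', hb', hab⟩ := exists_exit hq hδc hA hV
    refine ⟨a, ?_, fun i => ?_⟩
    · rw [hCl, mem_openClusterIn_iff]
      refine DCT16.reachable_of_pathIn (DCT16.pathIn_congrGraph (fun x y hx hy hxy => ?_) hpa)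
      rw [SimpleGraph.inf_adj]
      refine ⟨hxy, withinGraph_adj.2 ⟨?_, V_subset_slab ω m hx, V_subset_slab ω m hy⟩⟩
      exact (SimpleGraph.mem_edgeSet _).1 (hωE ((openGraph_adj _ _ _).1 hxy).1)
    · -- `b'` is within `15r` of `cen b`, and `a ∼ b'`
      subst hte
      have htgt : tgt e' = e'.1 + stepVec e'.2 := rfl
      rw [htgt]
      have hab1 := KozmaNitzan.abs_sub_le_one_of_adj hab (S.C.pax i)
      have hb'c : |b' (S.C.pax i) - 20 * S.C.r * (e'.1 + stepVec e'.2) i| ≤ 15 * S.C.r := by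
        rcases Finset.mem_union.1 hb' with h | h
        · obtain ⟨⟨hl1, hl2⟩, ht1, ht2⟩ := S.C.planar_of_mem_sBox h
          by_cases hi : i = e'.2.1
          · subst hi
            have hta : (e'.1 + stepVec e'.2) e'.2.1 = e'.1 e'.2.1 + sgOf e'.2 := by
              rw [Pi.add_apply, stepVec_apply_fst]
            rw [hta, abs_le]
            rcases sgOf_sign e'.2 with hs | hs <;> rw [hs] at hl1 hl2 ⊢ <;> constructor <;> nlinarith
          · have hi' : i = oth e'.2.1 := eq_oth_of_ne hi
            subst hi'
            have hta : (e'.1 + stepVec e'.2) (oth e'.2.1) = e'.1 (oth e'.2.1) := by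
              rw [Pi.add_apply, stepVec_apply_oth, add_zero]
            rw [hta, abs_le]; constructor <;> linarith
        · have := S.C.planar_of_mem_cIcc h i
          push_cast at this
          rw [abs_le]; constructor <;> linarith [this.1, this.2]
      have := abs_sub_abs_le_abs_sub (20 * (S.C.r : ℤ) * (e'.1 + stepVec e'.2) i - a (S.C.pax i))
        (20 * S.C.r * (e'.1 + stepVec e'.2) i - b' (S.C.pax i))
      have e1 : 20 * (S.C.r : ℤ) * (e'.1 + stepVec e'.2) i - a (S.C.pax i) -
          (20 * S.C.r * (e'.1 + stepVec e'.2) i - b' (S.C.pax i)) = b' (S.C.pax i) - a (S.C.pax i) := by ring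
      rw [e1] at this
      rw [abs_sub_comm] at hb'c
      linarith
  by_contra hfin
  have hClfin : Cl.Finite := Set.not_infinite.1 hfin
  have hF : (⋃ a ∈ Cl, {b : Site 2 | ∀ i : Fin 2, |20 * (S.C.r : ℤ) * b i - a (S.C.pax i)| ≤ 16 * S.C.r}).Finite :=
    hClfin.biUnion fun a _ => S.finite_setOf_near a
  refine hinf ((hF.union (Set.finite_singleton 0)).subset fun b hb => ?_)
  by_cases hb0 : b = 0
  · exact Or.inr hb0
  · obtain ⟨a, ha, hnr⟩ := hnear b hb hb0
    exact Or.inl (Set.mem_biUnion ha hnr)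

end RunFK

/-- **Soundness of KN's FK scheme** (FO-05 `FKScheme.Sound`): `U₀ = E(Q_0)` consists of lattice edges, and an
infinite macro-cluster on the initial event forces `0 ↔ ∞` (given (32)-FK at the origin and `δ ≤ 1`).
[cite: KozmaNitzan2024, §4 pp. 26–27 ((2)–(3))] -/
theorem knScheme_sound (hq : 1 ≤ q) (hδc : S.δc ≤ 1) (hQ0 : ∀ du : MDir, OriginFK S q du) :
    (knScheme S q).Sound := by
  refine ⟨fun x hx => ?_, ?_⟩
  · have hx' : x ∈ S.U₀ := Finset.mem_coe.1 hx
    rw [KSch.U₀, mem_edgesIn_iff] at hx'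
    exact hx'.1
  · rintro ω ⟨hA, hinf⟩
    by_cases hωE : ω ⊆ (zdGraph d).edgeSet
    · exact Or.inl (percolatesVia_subset_percolatesAt _ _
        (RunFK.mem_percolatesVia_of_infinite hq hδc hQ0 hωE hA hinf))
    · exact Or.inr hωE

/-- **C3b — `FKLawfulOfCriterion d q` for every `q ≥ 1`**: a `UFSC0 d q p r ε₀` witness `S` yields the sound
FK history scheme `knScheme S q`, robustly lawful at `(p, 4ε₀)` with at most `knFreshBound S` fresh lattice edges
per region (Kozma–Nitzan's Theorem 6 run under free boundary conditions, FT-07 (a)–(f)).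
[cite: KozmaNitzan2024, §4 Theorem 6, pp. 25–31] [cite: Grimmett2006, Thm. (3.7), eq. (3.22)] -/
theorem fkLawfulOfCriterion (hq : 1 ≤ q) : FKLawfulOfCriterion d q := by
  intro p r ε₀ hU
  obtain ⟨S, hp, -, -, hδc, hQ0, hbad⟩ := hU
  subst hp
  exact ⟨knFreshBound S, knScheme S q, fkRobustLawful_knScheme hq hQ0 hbad, knScheme_sound hq hδc hQ0⟩

/-- **C3b on `ℤ³` for every `q ≥ 1`** (FO-05's programme form `FKLawfulOfCriterionZ3`), from `fkLawfulOfCriterion`.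
[cite: KozmaNitzan2024, §4 Theorem 6] -/
theorem fkLawfulOfCriterionZ3 : FKLawfulOfCriterionZ3 := fun _ hq => fkLawfulOfCriterion hq

end Summit.CriticalPhenomena.PercolationContinuityZ3.Theorems.FK

end
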